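import Literature.MathematicalPhysics.QuantumLattice.SectorisedKernelNormRefinementPlateau
import HarnessLib

/-!
# Prescribed-legs sector sums: the BRIDGE from the Grassmann supplier's hypothesis (indicator products over constrained slots of a
# label-valued kernel) to the sectorised prescribed sums (sector tuples with a set of legs held fixed)

Topic `MathematicalPhysics/QuantumLattice`; companion of `SectorisedKernelNormPrescribedSums` / `SectorisedKernelNormRefinementPrescribed` (the
sectorised side: `ε^m Σ_{σ : σ|_E = τ|_E} Σ_{x : x_p = y} ‖W_σ(x)‖`) and of the prescribed-leg Grassmann suppliers
`GrassmannLaplacianTruncatedBoundPrescribed` / `GrassmannVertexPositionsProtected` (the Grassmann side asks, for a kernel `K` on labels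
`Γ = P × S`, a set `T` of constrained slots injected by `ι` into the legs, one further slot `t ∉ range ι` pinned at `a : Γ` and per-slot Boolean
predicates: `Σ_{Y : Y t = a} ‖K Y‖ · ∏_{j : T} [A j (Y (ι j))] ≤ N |T|`).  Benfatto–Giuliani–Mastropietro 2006 §2.7 (2.70) / §2.8 (2.88)–(2.90): with
the predicates «sector label of the slot = the prescribed one» the two currencies agree —

* `sum_norm_prescribedSlots_eq` — for `K Y = W (sec ∘ Y) (pos ∘ Y)`:
  `Σ_{Y : Y t = a} ‖K Y‖ · ∏_{j : T} [sec (Y (ι j)) = s j] = Σ_{σ : σ t = a.2, σ (ι j) = s j ∀ j} Σ_{x : x t = a.1} ‖W σ x‖`;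
* `prescribedSlots_filter_eq` — the constraint set is a prescription on the leg set `E = insert t (range ι)` (`|E| = |T| + 1` when `ι` is injective
  and misses `t`, private `card_insert_image_eq`): `{σ : σ t = a.2 ∧ ∀ j, σ (ι j) = s j} = {σ : σ|_E = τ|_E}` for the extension `τ` of `(t ↦ a.2, ι j ↦ s j)`;
* **`sum_norm_prescribedSlots_le_of_prescribedSum_le`** — hence a bound `B(F)` on ALL sectorised prescribed sums with `|E| = F + 1` legs held
  fixed gives the supplier's hypothesis with `N |T| := B(|T|)` (times `ε^{-m}`: the sectorised sums carry the weight `ε^m`);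
* the Hubbard forms `sum_norm_kernel_sectorPreimage_prescribedSlots_eq` / `…_le_of_prescribedSum_le` for `K = kernel (sectorPreimage β F G) (m+1)`
  (`= ε_x^{m+1} · W_{F,σ}(x)`, `kernel_sectorPreimage_eq_sectorisedKernel`): the supplier's sum is `ε_x ·` (the sectorised prescribed sum).

Cell gate-hubbard-kl, K3 engine child clause (E1), LEVELS track: this is «how a model-side prover discharges `hN`» (G1L-NOTE §4) — the values
`N(m′, F)` are then the level laws / the re-measured sizes of `…EngineNormsJumpResectorisationPrescribed`.  Everything is proved; no definition.

## Sources

G. Benfatto, A. Giuliani, V. Mastropietro, Ann. Henri Poincaré 7 (2006) 809–898, §2.7 (2.70), §2.8 (2.88)–(2.90), App. A3 Lemma A3.1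
[`BenfattoGiulianiMastropietro2006`].
-/

noncomputable section

namespace Literature.MathematicalPhysics.QuantumLattice

open Finset

section Generic

variable {𝕜 : Type*} [RCLike 𝕜] {S P : Type*} [Fintype S] [DecidableEq S] [Fintype P] [DecidableEq P] {ι₀ : Type*}

omit [DecidableEq S] [DecidableEq P] in
/-- Splitting a constrained sum over tuples of (position, label) pairs into the label tuples and the position tuples. [folklore] -/
private theorem sum_tuple_prod_eq_sum_sum_b {α : Type*} [AddCommMonoid α] (n : ℕ)
    (g : (Fin n → P × S) → α) : ∑ Y, g Y = ∑ σ : Fin n → S, ∑ x : Fin n → P, g (fun i => (x i, σ i)) := by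
  rw [← (Equiv.arrowProdEquivProdArrow (Fin n) (fun _ => P) (fun _ => S)).symm.sum_comp, Fintype.sum_prod_type, sum_comm]
  rfl

/-- **The supplier's indicator sum in sectorised currency**: for a kernel of the form `K Y = W (sec ∘ Y) (pos ∘ Y)` on labels `P × S`, a finite
set `T` of constrained slots injected by `ι` into the legs with prescribed sectors `s`, and one slot `t` pinned at `a`,
`Σ_{Y : Y t = a} ‖K Y‖ · ∏_{j : T} [ (Y (ι j)).2 = s j ] = Σ_{σ : σ t = a.2 ∧ ∀ j, σ (ι j) = s j} Σ_{x : x t = a.1} ‖W σ x‖`.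
[cite: BenfattoGiulianiMastropietro2006, §2.7 (2.70) and §2.8 (2.88)-(2.90)] -/
theorem sum_norm_prescribedSlots_eq {m : ℕ} (W : (Fin (m + 1) → S) → (Fin (m + 1) → P) → 𝕜) (T : Finset ι₀)
    (ι : T → Fin (m + 1)) (s : T → S) (t : Fin (m + 1)) (a : P × S) :
    ∑ Y ∈ univ.filter (fun Y : Fin (m + 1) → P × S => Y t = a),
        ‖W (fun i => (Y i).2) (fun i => (Y i).1)‖ * ∏ j : T, (if (Y (ι j)).2 = s j then (1 : ℝ) else 0) =
      ∑ σ ∈ univ.filter (fun σ : Fin (m + 1) → S => σ t = a.2 ∧ ∀ j : T, σ (ι j) = s j),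
        ∑ x ∈ univ.filter (fun x : Fin (m + 1) → P => x t = a.1), ‖W σ x‖ := by
  classical
  rw [sum_filter, sum_tuple_prod_eq_sum_sum_b (m + 1), sum_filter]
  refine sum_congr rfl fun σ _ => ?_
  -- the indicator product depends on `σ` only
  have hprod : ∀ x : Fin (m + 1) → P,
      (∏ j : T, (if ((fun i => (x i, σ i)) (ι j)).2 = s j then (1 : ℝ) else 0)) =
        if ∀ j : T, σ (ι j) = s j then 1 else 0 := by
    intro x
    simp only
    split_ifs with h
    · exact prod_eq_one fun j _ => if_pos (h j)
    · push Not at h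
      obtain ⟨j, hj⟩ := h
      exact prod_eq_zero (mem_univ j) (if_neg hj)
  simp_rw [hprod]
  by_cases hσ : σ t = a.2 ∧ ∀ j : T, σ (ι j) = s j
  · rw [if_pos hσ, sum_filter]
    refine sum_congr rfl fun x _ => ?_
    rw [if_pos hσ.2, mul_one]
    simp only [Prod.ext_iff, hσ.1, and_true]
  · rw [if_neg hσ]
    refine sum_eq_zero fun x _ => ?_
    by_cases hx : (fun i => (x i, σ i)) t = a
    · rw [if_pos hx]
      have hσt : σ t = a.2 := (Prod.ext_iff.1 hx).2
      have hnot : ¬ ∀ j : T, σ (ι j) = s j := fun h => hσ ⟨hσt, h⟩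
      rw [if_neg hnot, mul_zero]
    · rw [if_neg hx]

omit [Fintype P] [DecidableEq P] in
/-- **The slot constraints are a prescription on the leg set `insert t (range ι)`**: if `ι` misses `t`, then with the extension
`τ e := a.2` at `e = t`, `s j` at `e = ι j`, anything elsewhere, `{σ : σ t = a.2 ∧ ∀ j, σ (ι j) = s j} = {σ : ∀ e ∈ insert t (image ι), σ e = τ e}`
for `τ` any function with `τ t = a.2` and `τ (ι j) = s j`. [cite: BenfattoGiulianiMastropietro2006, §2.8 (2.88)-(2.90)] -/
theorem prescribedSlots_filter_eq {m : ℕ} (T : Finset ι₀) (ι : T → Fin (m + 1)) (s : T → S) (t : Fin (m + 1)) (a : P × S)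
    (τ : Fin (m + 1) → S) (hτt : τ t = a.2) (hτι : ∀ j : T, τ (ι j) = s j) :
    univ.filter (fun σ : Fin (m + 1) → S => σ t = a.2 ∧ ∀ j : T, σ (ι j) = s j) =
      univ.filter (fun σ : Fin (m + 1) → S => ∀ e ∈ insert t ((univ : Finset T).image ι), σ e = τ e) := by
  classical
  ext σ
  simp only [mem_filter, mem_univ, true_and, mem_insert, mem_image, forall_eq_or_imp, hτt]
  constructor
  · rintro ⟨h1, h2⟩
    refine ⟨h1, ?_⟩
    rintro e ⟨j, hj⟩
    rw [← hj, hτι j]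
    exact h2 j
  · rintro ⟨h1, h2⟩
    exact ⟨h1, fun j => by rw [← hτι j]; exact h2 (ι j) ⟨j, rfl⟩⟩

/-- The leg set `insert t (range ι)` has `|T| + 1` elements when `ι` is injective and misses `t`. [folklore] -/
private theorem card_insert_image_eq {m : ℕ} (T : Finset ι₀) (ι : T → Fin (m + 1)) (hι : Function.Injective ι) (t : Fin (m + 1))
    (ht : ∀ j : T, ι j ≠ t) : (insert t ((univ : Finset T).image ι)).card = T.card + 1 := by
  classical
  rw [card_insert_of_notMem, card_image_of_injective _ hι, card_univ, Fintype.card_coe]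
  simp only [mem_image, mem_univ, true_and, not_exists]
  exact fun j => ht j

/-- **Discharging the supplier's hypothesis from the sectorised prescribed sums**: if EVERY sectorised prescribed sum of `W` with a leg set of
`F + 1` elements held fixed (the position of one of them pinned) is `≤ B`, i.e.
`ε^m Σ_{σ : σ|_E = τ|_E} Σ_{x : x_p = y} ‖W σ x‖ ≤ B` whenever `|E| = F + 1`, `p ∈ E`, then for `K Y = W (sec ∘ Y) (pos ∘ Y)`, every `T` with
`|T| = F`, every injective `ι` missing `t`, every `a` and prescribed sectors `s`:
`ε^m · Σ_{Y : Y t = a} ‖K Y‖ · ∏_{j : T} [ (Y (ι j)).2 = s j ] ≤ B`. [cite: BenfattoGiulianiMastropietro2006, §2.8 (2.88)-(2.90), App. A3 Lemma A3.1] -/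
theorem sum_norm_prescribedSlots_le_of_prescribedSum_le {ε : ℝ} {m : ℕ} (W : (Fin (m + 1) → S) → (Fin (m + 1) → P) → 𝕜)
    {F : ℕ} {B : ℝ}
    (hB : ∀ (E : Finset (Fin (m + 1))) (τ : Fin (m + 1) → S) (p : Fin (m + 1)), p ∈ E → E.card = F + 1 → ∀ y : P,
      ε ^ m * ∑ σ ∈ univ.filter (fun σ : Fin (m + 1) → S => ∀ e ∈ E, σ e = τ e),
        ∑ x ∈ univ.filter (fun x : Fin (m + 1) → P => x p = y), ‖W σ x‖ ≤ B)
    (T : Finset ι₀) (hT : T.card = F) (ι : T → Fin (m + 1)) (hι : Function.Injective ι) (t : Fin (m + 1))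
    (ht : ∀ j : T, ι j ≠ t) (s : T → S) (a : P × S) :
    ε ^ m * ∑ Y ∈ univ.filter (fun Y : Fin (m + 1) → P × S => Y t = a),
        ‖W (fun i => (Y i).2) (fun i => (Y i).1)‖ * ∏ j : T, (if (Y (ι j)).2 = s j then (1 : ℝ) else 0) ≤ B := by
  classical
  -- an extension of the prescription to all legs
  set τ : Fin (m + 1) → S := fun e => if h : ∃ j : T, ι j = e then s (Classical.choose h) else a.2 with hτ
  have hτt : τ t = a.2 := by
    simp only [hτ]
    rw [dif_neg]
    rintro ⟨j, hj⟩
    exact ht j hj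
  have hτι : ∀ j : T, τ (ι j) = s j := by
    intro j
    have hex : ∃ j' : T, ι j' = ι j := ⟨j, rfl⟩
    simp only [hτ]
    rw [dif_pos hex, hι (Classical.choose_spec hex)]
  rw [sum_norm_prescribedSlots_eq W T ι s t a, prescribedSlots_filter_eq T ι s t a τ hτt hτι]
  exact hB _ τ t (mem_insert_self _ _) (by rw [card_insert_image_eq T ι hι t ht, hT]) a.1

end Generic

/-! ### The Hubbard forms -/

section Hubbard

open GrassmannAlgebra Literature.Probability.LatticeModels

variable {L M : ℕ} [NeZero L] {N : ℕ} {ι₀ : Type*}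

/-- **The supplier's indicator sum for the sector preimage, in sectorised currency**: for `K = kernel (sectorPreimage β F G) (m+1)`
(`= ε_x^{m+1} · W_{F,σ}(x)` at `Y = (x_i, σ_i)_i`),
`Σ_{Y : Y t = a} ‖K Y‖ · ∏_{j : T} [ (Y (ι j)).2 = s j ] = ε_x · (ε_x^m Σ_{σ : σ t = a.2 ∧ ∀ j, σ (ι j) = s j} Σ_{x : x t = a.1} ‖W_{F,σ}(x)‖)` (`0 ≤ β`).
[cite: BenfattoGiulianiMastropietro2006, §2.7 (2.70)] -/
theorem sum_norm_kernel_sectorPreimage_prescribedSlots_eq {β : ℝ} (hβ : 0 ≤ β) (F : Fin N → FreqMomentum L M → ℂ)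
    (G : HubbardGrassmann L M) (m : ℕ) (T : Finset ι₀) (ι : T → Fin (m + 1)) (s : T → SectorLeg N) (t : Fin (m + 1))
    (a : SpaceTimeIdx L M × SectorLeg N) :
    ∑ Y ∈ univ.filter (fun Y : Fin (m + 1) → SpaceTimeIdx L M × SectorLeg N => Y t = a),
        ‖kernel ℂ (sectorPreimage β F G) (m + 1) Y‖ * ∏ j : T, (if (Y (ι j)).2 = s j then (1 : ℝ) else 0) =
      imagTimeWeight β M * (imagTimeWeight β M ^ m *
        ∑ σ ∈ univ.filter (fun σ : Fin (m + 1) → SectorLeg N => σ t = a.2 ∧ ∀ j : T, σ (ι j) = s j),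
          ∑ x ∈ univ.filter (fun x : Fin (m + 1) → SpaceTimeIdx L M => x t = a.1), ‖sectorisedKernel L M β F G (m + 1) σ x‖) := by
  have hε : 0 ≤ imagTimeWeight β M := imagTimeWeight_nonneg hβ M
  have hK : ∀ Y : Fin (m + 1) → SpaceTimeIdx L M × SectorLeg N, ‖kernel ℂ (sectorPreimage β F G) (m + 1) Y‖ =
      ‖((((imagTimeWeight β M : ℝ) : ℂ) ^ (m + 1)) • sectorisedKernel L M β F G (m + 1)) (fun i => (Y i).2) (fun i => (Y i).1)‖ := by
    intro Y
    rw [kernel_sectorPreimage_eq_sectorisedKernel β F G (m + 1) Y, Pi.smul_apply, Pi.smul_apply, smul_eq_mul]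
  simp_rw [hK]
  rw [sum_norm_prescribedSlots_eq (𝕜 := ℂ)
    ((((imagTimeWeight β M : ℝ) : ℂ) ^ (m + 1)) • sectorisedKernel L M β F G (m + 1)) T ι s t a]
  have hn : ∀ σ x, ‖((((imagTimeWeight β M : ℝ) : ℂ) ^ (m + 1)) • sectorisedKernel L M β F G (m + 1)) σ x‖ =
      imagTimeWeight β M ^ (m + 1) * ‖sectorisedKernel L M β F G (m + 1) σ x‖ := by
    intro σ x
    rw [Pi.smul_apply, Pi.smul_apply, smul_eq_mul, norm_mul, norm_pow, Complex.norm_real, Real.norm_of_nonneg hε]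
  simp_rw [hn]
  rw [← mul_assoc, ← pow_succ', mul_sum]
  exact sum_congr rfl fun σ _ => by rw [mul_sum]

/-- **Discharging the supplier's hypothesis for the sector preimage**: if every sectorised prescribed sum of `W_F(G)` in degree `m + 1` with
`F + 1` legs held fixed is `≤ B` (`ε_x^m Σ_{σ|_E = τ|_E} Σ_{x_p = y} ‖W_{F,σ}(x)‖ ≤ B` for `|E| = F + 1`, `p ∈ E`), then for every `T` with
`|T| = F`, injective `ι` missing `t`, prescribed labels `s` and pin `a`:
`Σ_{Y : Y t = a} ‖kernel (sectorPreimage β F G) (m+1) Y‖ · ∏_{j : T} [ (Y (ι j)).2 = s j ] ≤ ε_x · B` — the `hN`/`Nv u F` input of the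
prescribed-leg Grassmann suppliers with `N (m+1) F := ε_x · B(F)`. [cite: BenfattoGiulianiMastropietro2006, §2.8 (2.88)-(2.90), App. A3 Lemma A3.1] -/
theorem sum_norm_kernel_sectorPreimage_prescribedSlots_le_of_prescribedSum_le {β : ℝ} (hβ : 0 ≤ β)
    (F : Fin N → FreqMomentum L M → ℂ) (G : HubbardGrassmann L M) (m : ℕ) {Fc : ℕ} {B : ℝ}
    (hB : ∀ (E : Finset (Fin (m + 1))) (τ : Fin (m + 1) → SectorLeg N) (p : Fin (m + 1)), p ∈ E → E.card = Fc + 1 →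
      ∀ y : SpaceTimeIdx L M,
        imagTimeWeight β M ^ m * ∑ σ ∈ univ.filter (fun σ : Fin (m + 1) → SectorLeg N => ∀ e ∈ E, σ e = τ e),
          ∑ x ∈ univ.filter (fun x : Fin (m + 1) → SpaceTimeIdx L M => x p = y), ‖sectorisedKernel L M β F G (m + 1) σ x‖ ≤ B)
    (T : Finset ι₀) (hT : T.card = Fc) (ι : T → Fin (m + 1)) (hι : Function.Injective ι) (t : Fin (m + 1)) (ht : ∀ j : T, ι j ≠ t)
    (s : T → SectorLeg N) (a : SpaceTimeIdx L M × SectorLeg N) :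
    ∑ Y ∈ univ.filter (fun Y : Fin (m + 1) → SpaceTimeIdx L M × SectorLeg N => Y t = a),
        ‖kernel ℂ (sectorPreimage β F G) (m + 1) Y‖ * ∏ j : T, (if (Y (ι j)).2 = s j then (1 : ℝ) else 0) ≤
      imagTimeWeight β M * B := by
  classical
  have hε : 0 ≤ imagTimeWeight β M := imagTimeWeight_nonneg hβ M
  rw [sum_norm_kernel_sectorPreimage_prescribedSlots_eq hβ F G m T ι s t a]
  refine mul_le_mul_of_nonneg_left ?_ hε
  -- an extension of the prescription to all legs
  set τ : Fin (m + 1) → SectorLeg N := fun e => if h : ∃ j : T, ι j = e then s (Classical.choose h) else a.2 with hτ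
  have hτt : τ t = a.2 := by
    simp only [hτ]
    rw [dif_neg]
    rintro ⟨j, hj⟩
    exact ht j hj
  have hτι : ∀ j : T, τ (ι j) = s j := by
    intro j
    have hex : ∃ j' : T, ι j' = ι j := ⟨j, rfl⟩
    simp only [hτ]
    rw [dif_pos hex, hι (Classical.choose_spec hex)]
  rw [prescribedSlots_filter_eq T ι s t a τ hτt hτι]
  exact hB _ τ t (mem_insert_self _ _) (by rw [card_insert_image_eq T ι hι t ht, hT]) a.1

end Hubbard

end Literature.MathematicalPhysics.QuantumLattice

end
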